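import Literature.MathematicalPhysics.QuantumFieldTheory.Balaban1983to89.B10Eq25Rate
import Literature.MathematicalPhysics.QuantumFieldTheory.Balaban1983to89.B10Eq65PolymerSum
import Literature.MathematicalPhysics.QuantumFieldTheory.Balaban1983to89.TreeLengthTorusTransfer
import Literature.Probability.LatticeModels.LatticeAnimals
import Literature.Probability.LatticeModels.PolymerGasGeometric

/-!
# `Balaban1983to89.B10Eq25WalkGeometryTorus` — [Balaban1985UV3] p. 262, (23) ⇒ (24)–(25) ⇒ (65)₁: THE GEOMETRY OF THE
# LOCALIZATIONS «X_m are connected unions of several big blocks», «X_{m−1} ∩ X_m ≠ ∅», «This localization is simply a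
# union of all these sets», «if the big blocks are scaled to unit cubes» ON THE PERIODIC CARRIER — the walk states
# `(α, X)` with their labels, the walk-state ADJACENCY COUNT from the tree's lattice-animal count (for the share-a-block
# AND for the closed-block-contact reading), the rescaling law (N), the volume law, and the edge (23) ⇒ (25) ⇒ (65)₁ with
# every geometric hypothesis discharged on the torus `(ℤ/N)^d` of big blocks (`TreeLengthTorus`)

statement-level skeleton of published theorems with citation tags; proofs where landed; nothing here is a claim about
the Yang–Mills mass gap.

CITATION HEADER (lean-in-tree rule 2026-08-18).  T. Bałaban, *Ultraviolet stability of three-dimensional lattice pure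
gauge field theories*, Commun. Math. Phys. **102**, 255–275 (1985), bib `Balaban1985UV3` (cell paper B10; journal page =
PDF page + 254; p. 262 = PDF p. 8, p. 273 = PDF p. 19), with [5] of the paper = T. Bałaban, *Propagators for lattice gauge
theories in a background field*, Commun. Math. Phys. **99**, 389–434 (1985), bib `Balaban1985BackgroundPropagators` (B9;
pp. 409–410 = PDF pp. 21–22).  The sentences were re-read on the tree's own verbatim quotations (module docstrings of
`B10Eq25Rate`, `B10LogDet63`, `B9Thm37Sum` §4, `B10Eq65PolymerSum`, and the cell record `pub-balaban/GAPS.md` C-b10g12-1);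
nothing of the manuscripts is asserted as a fact: the cluster expansion, its terms and the bound (23) for them stay the
hypothesis `B10Eq25Rate.WalkTermBound23`; everything else below is finite combinatorics, PROVED.

TWIN FILE.  This is the PERIODIC twin of `B10Eq25WalkGeometry` (seat `pub-ymgap-dag-n08-b`, the same p. 262 geometry on a
free-boundary WINDOW `B ⊂ ℤ^d` over `TreeLengthCubeSystem.sys B`), written at the planner's request («port §1–§5 to print's
periodic T₁ over `TreeLengthTorus`», pub-ymgap INBOX [DAGLEAD-G0-REBALANCE-7B-N08]) on the papers' own carrier: the torus of
[Balaban1987RG1] p. 251 ∕ p. 257 (`TreeLengthTorus.tsys d N`, `tcubeSys d N`; wrap-around walls included).  Differences: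
(i) the walk states carry their LABEL `α ∈ Λ` (print: «ω = ((α₀, X₀), …, (αₙ, Xₙ))»), so the entropy constant carries the
factor `|Λ|`; (ii) the adjacency count comes from the lattice-animal count `LatticeAnimals.card_connectedFamily_le`
([FriedliVelenik2017] Lemma 3.38 ∕ (5.27)) with the explicit constant `(2d+1)^{2(s₀−1)}` instead of the anchored
tree-decay sum; (iii) besides the share-a-block reading of «X_{m−1} ∩ X_m ≠ ∅» (used, as in the twin, for the walk's
localization domain) the COUNT is also proved for the closed-block-contact reading (a block of the one inside the
enlarged cube □̃ = `TreeLengthTorusTransfer.tblock` of a block of the other: `3^d` per block); (iv) the one new geometric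
lemma is the UNION lemma for torus-face-connected families (`tFaceConnected_union`; `B13Ineq232.faceConnected_union` is
the `ℤ^d` statement).

THE PRINTED TEXT (p. 262 [PDF 8], verbatim).  «We localize vertices in big blocks by a decomposition of unity, and we
expand the propagators C⁽⁰⁾(Ω₁, U₁) into the generalized random walk expansion described in [5] […] Each expression
corresponds to a graph with vertices localized in cubes {□_j}. A line of the graph connecting vertices □_i, □_j is replaced
by a random walk ω = ((α₀, X₀), (α₁, X₁), …, (αₙ, Xₙ)) satisfying □_i ∩ X₀ ≠ ∅, X_{m−1} ∩ X_m ≠ ∅, m = 1, …, n, X_m ∩ □_j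
≠ ∅. A term in the expression, corresponding to the walk ω, satisfies the bound (3.108) [5], i.e. can be bounded by
O(1)O(M₁^{−(1/2)})^{|ω|}M₁^{−(1/2)|ω|} exp(−½δ₀d(ω, □_i, □_j)), (23) […] Let us recall that the sets X_m are connected
unions of several big blocks. The localizations {□_j} and the walks ω replacing lines of the graph define a localization X
of the considered expression. This localization is simply a union of all these sets. […] Localizations X are connected
unions of big blocks. Following [19] we define a linear size 𝓛(X) of a localization X as the length of a shortest tree
graph connecting the centers of big blocks in X, and other points, if the big blocks are scaled to unit cubes […] With this
definition we have |𝒫′₁(g₀, X, U₁)| ≦ O(g₀)e^{−κ𝓛(X)} (25) where κ can be arbitrarily large if M₁ is sufficiently large.»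
[5] p. 409 (3.90): «ω = (□₀, □₁, ⋯, □ₙ), □ᵢ ∈ 𝒟, □ᵢ ∩ □ᵢ₊₁ ≠ ∅»; p. 410: «We will use the factor O(M^{−1/2}) to control the
sum over random walks ω».  p. 273 (65): «From (25), which holds for arbitrary j, we get easily |E^{(j)}| ≤ O(1)|T₁^{(j)}|».

WHAT WAS ALREADY IN THE TREE (used BY NAME).  `B9Thm37Sum.walksFrom` ∕ `card_walksFrom_le` (walks and their count GIVEN a
successor bound `hD`); `B10Eq25Rate.WalkTermBound23` ∕ `RescaleLaw` ∕ `rate25` ∕ `bound25_of_bound23` ∕ `activitiesOf` ((23)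
⇒ (25) over abstract states, with the binders `hD`, `hV`, `hstart`, `hsc`, `hvol`); `B10Eq65PolymerSum.norm_total_le_of_bound25`
((25) ⇒ (65)₁ over a `CubeSystem`); the torus model `TreeLengthTorus` (`TPt`, `TAdj`, `TLinked`, `TFaceConnected`, `tsys`,
`tcubeSys`, `tdegreeLE` : 2d, `tvolumeLeaf` : 4·2^d, `torusTreeLen_le_card_sub_one`, `card_tcube`) and its enlarged cubes
(`TreeLengthTorusTransfer.tblock` = □̃ of [Balaban1987RG1] p. 257 on the torus, `card_tblock_le` : 3^d, `mem_tblock_self`,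
`tLinked_mono` ∕ `tLinked_trans`); the lattice-animal count `Literature.Probability.LatticeModels.card_connectedFamily_le`;
`IsRConnected` ∕ `Touches` of `PolymerGasGeometric`.

WHAT IS HERE (all PROVED; `d`, `N ≥ 1`, the finite label type `Λ` and the size bound `s₀` are parameters).
* §1 `card_touching_connected_le` — over an ABSTRACT block type with a connectivity relation (neighbour lists `≤ Δ`) and a
  meeting relation (lists `≤ Θ`, containing the block): a finite family of connected block sets of `≤ s₀` blocks each
  MEETING a fixed block set `W` has `≤ |W|·Θ·(Δ+1)^{2(s₀−1)}` members (`card_connectedFamily_le` BY NAME).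
* §2 THE WALK STATES `State Λ Adj s₀ = Λ × CFam Adj s₀` («(α, X), X a connected union of ≤ s₀ blocks»), the successor lists
  `stateNbrs Meet` («X_{m−1} ∩ X_m ≠ ∅»: the block sets touch for `Meet`; the state itself included), `mem_stateNbrs`,
  `self_mem_stateNbrs`, `nonempty_state`; **`card_stateNbrs_le`** `≤ |Λ|·(s₀·Θ·(Δ+1)^{2(s₀−1)})`; the SHARE-A-BLOCK reading =
  the empty meeting relation: `mem_stateNbrs_share` (↔ a common block), **`card_stateNbrs_share_le`** `≤ |Λ|·(s₀·(Δ+1)^{2(s₀−1)})`;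
  `card_walksFrom_state_le` (`≤ D𝔤ⁿ` walks, `B9Thm37Sum.card_walksFrom_le` BY NAME).
* §3 THE TORUS: **`tFaceConnected_union`** (two torus-face-connected families with a common block have a
  torus-face-connected union), `tFaceConnected_of_isRConnected`; the counts on the torus **`card_stateNbrs_torus_le`**
  (closed-block-contact reading via □̃ = `tblock`: `|Λ|·(s₀·3^d·(2d+1)^{2(s₀−1)})`), **`card_stateNbrs_torus_share_le`**
  (share-a-block: `|Λ|·(s₀·(2d+1)^{2(s₀−1)})`), the `s₀ = 1` case (`|Λ|·3^d` = the *"D = 3^d"* of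
  `B9Thm37Sum.card_walksFrom_le`'s docstring), `card_walksFrom_torus_le`.
* §4 THE WALK GEOMETRY ON THE TORUS (share-a-block successor lists, as in the twin): anchors `Λ × (ℤ/N)^d` and their one-block
  states `single`, `cubesQ` (the labelled one-block states of the blocks of a domain; `card_cubesQ = |Λ|·#blocks`),
  `card_anchors_le_one` (`hV`, V = 1); `wunion`, `walk_props` (the union of a walk's states from `(α, X₀)` contains `X₀`, is a
  torus localization domain — `tFaceConnected_union` along the shared blocks — and has `≤ s₀(n+1)` blocks); `domOf` («simply
  a union of all these sets» as an element of `(tsys d N).Dom`), `domOf_val`, `anchor_mem_domOf`, `single_mem_cubesQ_domOf`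
  (`hstart`), `card_domOf_le`, `torusTreeLen_domOf_le` (`𝓛 ≤ s₀n + s₀ − 1`, (2.30) upper half on the torus BY NAME);
  **`rescaleLaw_torus`** = `RescaleLaw (tsys d N) … M 0 s₀ s₀` — the COUNT LAW (N) of `B10Eq25Rate`'s docstring ∕ C-b10g12-1
  on the periodic carrier; **`volBoundK1_torus`** = `B13.VolBoundK1 (tsys d N) (#cubesQ) (|Λ|·4·2^d)` (`tvolumeLeaf` BY NAME).
* §5 **`bound25_torus`** — `B10Eq25Rate.bound25_of_bound23` on the torus with `hD`, `hV`, `hstart`, `hsc`, `hvol` ALL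
  DISCHARGED: for every `κ ≥ 0`, `g > 0` and `M₁ > 0` past the entropy threshold `2·D𝔤·c·e^{κs₀} ≤ M₁`,
  `D𝔤 = |Λ|·(s₀·(2d+1)^{2(s₀−1)})`, the analytic leaf (23) ALONE gives `B10.Bound25Printed` for the regrouped terms with rate
  `κ − 1` and `O(g₀) = (2A₀C·e^{κs₀}·|Λ|·4·2^d)·g₀`; **`norm_total_torus`** — (65)₁ on the torus: `‖Σ_X E_log(X, U)‖ ≤
  (2A₀Ce^{κs₀}·|Λ|·4·2^d)·g·K₀(4·2^d, 2d)·N^d` for `κ − 1 ≥ κ₀(4·2^d, 2d)` (`B10Eq65PolymerSum.norm_total_le_of_bound25` over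
  `tcubeSys d N` with `tdegreeLE`, `tvolumeLeaf`, `card_tcube` BY NAME) — `N^d = |π₁| = M₁^{−d}|T₁|`, print's «O(1)|T₁^{(j)}|».
* §6 (v1.1, append-only) THE CONTACT READING AT THE GEOMETRY LEVEL: with the successor lists «a block inside □̃ of a block»
  the plain union of a walk's states need not be a connected family (corner contact), but the union of the ENLARGED
  families `X̃_m = tcollar X_m` is (`cwunion`, `cwalk_props`: `tFaceConnected_tcollar` + `tFaceConnected_union`, at most
  `3^d s₀ (n+1)` blocks by `card_tcollar_le`); `cdomOf` ∕ `cdomOf_val` ∕ `anchor_mem_cdomOf` ∕ `single_mem_cubesQ_cdomOf` ∕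
  `card_cdomOf_le` ∕ `torusTreeLen_cdomOf_le`; **`rescaleLaw_torus_contact`** = `RescaleLaw … M 0 (3^d s₀) (3^d s₀)` (the count
  law (N) with the one-layer fattening constant); **`bound25_torus_contact`** ∕ **`norm_total_torus_contact`** — (23) ⇒ (25) ⇒
  (65)₁ for the contact reading with `hD := card_stateNbrs_torus_le` and every geometric hypothesis discharged (a
  constants-only repair of print's «simply a union»: `s₀ ↦ 3^d s₀` in `ℓ₀, ℓ₁`; the twin's caveat (ii) closed on the torus).

WHAT IS NOT HERE (honest).  (i) The walk terms, the expansion and (23) = [5] (3.108) for them (`WalkTermBound23`; GAPS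
G-B10-04); (ii) the identification of `Λ`, `s₀` with the operators `R_α(X)` of [5] (3.107) and the extent of their
localization sets (print: «several»; `B9.Thm310Printed` is typed over an abstract `RWExpansion`) — PARAMETERS here;
(iii) for the walk GEOMETRY of §4–§5 «X_{m−1} ∩ X_m ≠ ∅» is read as sharing a BLOCK (as in the twin); under the
closed-block-contact reading the plain union of the states need not be face-connected (corner contact) and §6 uses the
□̃-FATTENED union instead — a reading with a constants-only price, not print's literal «simply a union»; (iv) only the count law (N) (rate of (25) logarithmic in M₁ via `B10Eq25Rate.entropy_iff`); the tube law (T)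
(rate linear in M₁) is seat `pub-ymgap-dag-n21-b`'s item; (v) «b ∈ □̃(a)» is a READING of «∩ ≠ ∅» for the closed cubes of
a cubic tiling (two closed cubes of the tiling intersect iff their centres are within sup-distance one cube side);
(vi) nothing of (41) ∕ (5) ∕ Theorems 1–2; N08's located gap stays OBJECT-level (𝒫′₁, C^{(0)}, Z^{(0)} of (22)–(25), GAPS
G-B10-03 ∕ 04).  Value = the geometric binders of the kernel edge (23) ⇒ (25) ⇒ (65)₁ discharged on the printed (periodic)
carrier; NOT summit progress.

## References
* [Balaban1985UV3] T. Bałaban, Commun. Math. Phys. 102 (1985) 255–275 — (23)–(25) p. 262, (65) p. 273.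
* [Balaban1985BackgroundPropagators] T. Bałaban, Commun. Math. Phys. 99 (1985) 389–434 — (3.90) p. 409, p. 410.
* [Balaban1987RG1] T. Bałaban, Commun. Math. Phys. 109 (1987) 249–301 — p. 251 (the torus), p. 257 (cubes, connected
  families, linear size).
* [Balaban1988RG2Cluster] T. Bałaban, Commun. Math. Phys. 116 (1988) 1–22 — (2.30) p. 18 (𝓛 ≤ #blocks − 1; volume law).
* [FriedliVelenik2017] S. Friedli, Y. Velenik, *Statistical Mechanics of Lattice Systems*, CUP (2017) — Lemma 3.38,
  eq. (5.27) (the lattice-animal count, `LatticeAnimals`).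
-/

noncomputable section

open Finset
open Literature.Probability.LatticeModels

namespace Literature.MathematicalPhysics.QuantumFieldTheory.Balaban1983to89.B10Eq25WalkGeometryTorus

open Literature.MathematicalPhysics.QuantumFieldTheory.Balaban1983to89
open Literature.MathematicalPhysics.QuantumFieldTheory.Balaban1983to89.B12TreeDecay (kappa₀ K₀)
open Literature.MathematicalPhysics.QuantumFieldTheory.Balaban1983to89.B10Eq25Rate (WalkTermBound23 RescaleLaw
  activitiesOf bound25_of_bound23)

/-! ## §1. The count: connected block families of bounded size meeting a fixed family -/

section Count

variable {B : Type*} [DecidableEq B] {Adj : B → B → Prop} {nbr : B → Finset B} {Δ : ℕ}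
  {Meet : B → B → Prop} {mnbr : B → Finset B} {Θ : ℕ}

/-- **The adjacency count behind «X_{m−1} ∩ X_m ≠ ∅»** ([Balaban1985UV3] p. 262).  Blocks `B` with a symmetric
connectivity relation `Adj` whose neighbour lists `nbr` have `≤ Δ` members, and a meeting relation `Meet` whose neighbour
lists `mnbr x` contain `x` and every `y` with `Meet x y` and have `≤ Θ` members.  Then a finite family `𝒯` of block sets,
each MEETING the fixed block set `W` (a common block, or a block of `W` meeting a block of the set: `Touches Meet W ·`),
each `Adj`-CONNECTED and of at most `s₀` blocks, has at most `|W|·Θ·(Δ+1)^{2(s₀−1)}` members: such a set contains one of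
the `≤ |W|·Θ` blocks listed in `mnbr w`, `w ∈ W`, and through a fixed block pass at most `(Δ+1)^{2(s₀−1)}` connected sets
of `≤ s₀` blocks (`card_connectedFamily_le`). [cite: FriedliVelenik2017, Lemma 3.38 and eq. (5.27)] -/
theorem card_touching_connected_le (hAdj : ∀ x y, Adj x y → Adj y x) (hΔ : ∀ x, (nbr x).card ≤ Δ)
    (hnbr : ∀ x y, Adj x y → y ∈ nbr x) (hself : ∀ x, x ∈ mnbr x) (hmnbr : ∀ x y, Meet x y → y ∈ mnbr x)
    (hΘ : ∀ x, (mnbr x).card ≤ Θ) (s₀ : ℕ) (W : Finset B) (𝒯 : Finset (Finset B))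
    (h𝒯 : ∀ Y ∈ 𝒯, Touches Meet W Y ∧ IsRConnected Adj Y ∧ Y.card ≤ s₀) :
    𝒯.card ≤ W.card * Θ * (Δ + 1) ^ (2 * (s₀ - 1)) := by
  classical
  -- every member contains a block `q ∈ mnbr w` for some `w ∈ W`
  have hcover : 𝒯 ⊆ W.biUnion fun w => (mnbr w).biUnion fun q => 𝒯.filter fun Y => q ∈ Y := by
    intro Y hY
    obtain ⟨⟨w, hw, q, hq, hwq⟩, -, -⟩ := h𝒯 Y hY
    refine mem_biUnion.2 ⟨w, hw, mem_biUnion.2 ⟨q, ?_, mem_filter.2 ⟨hY, hq⟩⟩⟩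
    rcases hwq with rfl | hm
    · exact hself w
    · exact hmnbr w q hm
  -- through a fixed block pass at most `(Δ+1)^{2(s₀-1)}` members
  have hfib : ∀ q : B, (𝒯.filter fun Y => q ∈ Y).card ≤ (Δ + 1) ^ (2 * (s₀ - 1)) := by
    intro q
    refine card_connectedFamily_le hAdj hΔ hnbr q (s₀ - 1) _ fun Y hY => ?_
    obtain ⟨hY𝒯, hqY⟩ := mem_filter.1 hY
    obtain ⟨-, ⟨-, hconn⟩, hcard⟩ := h𝒯 Y hY𝒯
    exact ⟨hqY, by omega, fun w hw => hconn q hqY w hw⟩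
  calc 𝒯.card ≤ (W.biUnion fun w => (mnbr w).biUnion fun q => 𝒯.filter fun Y => q ∈ Y).card :=
        card_le_card hcover
    _ ≤ ∑ w ∈ W, ((mnbr w).biUnion fun q => 𝒯.filter fun Y => q ∈ Y).card := card_biUnion_le
    _ ≤ ∑ w ∈ W, ∑ q ∈ mnbr w, (𝒯.filter fun Y => q ∈ Y).card :=
        sum_le_sum fun w _ => card_biUnion_le
    _ ≤ ∑ w ∈ W, ∑ _q ∈ mnbr w, (Δ + 1) ^ (2 * (s₀ - 1)) :=
        sum_le_sum fun w _ => sum_le_sum fun q _ => hfib q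
    _ = ∑ w ∈ W, (mnbr w).card * (Δ + 1) ^ (2 * (s₀ - 1)) := by
        refine sum_congr rfl fun w _ => ?_
        rw [sum_const, smul_eq_mul]
    _ ≤ ∑ _w ∈ W, Θ * (Δ + 1) ^ (2 * (s₀ - 1)) :=
        sum_le_sum fun w _ => Nat.mul_le_mul_right _ (hΘ w)
    _ = W.card * Θ * (Δ + 1) ^ (2 * (s₀ - 1)) := by
        rw [sum_const, smul_eq_mul, mul_assoc]

end Count

/-! ## §2. The walk states `(α, X)` of p. 262 as a finite type, their successor lists, and the successor count -/

section States

variable {B : Type} [DecidableEq B]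

/-- The block components of the walk states of [Balaban1985UV3] p. 262: «the sets X_m are connected unions of several
big blocks» — non-empty `Adj`-connected families of at most `s₀` blocks (`s₀` = print's «several», a parameter).
[cite: Balaban1985UV3, p.262 (after (23))] -/
def CFam (Adj : B → B → Prop) (s₀ : ℕ) : Type :=
  {X : Finset B // IsRConnected Adj X ∧ X.card ≤ s₀}

/-- Equality of block families is decidable. [folklore] -/
instance instDecidableEqCFam (Adj : B → B → Prop) (s₀ : ℕ) : DecidableEq (CFam Adj s₀) :=
  fun X Y => decidable_of_iff (X.1 = Y.1) Subtype.ext_iff.symm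

/-- Over finitely many blocks there are finitely many block families. [folklore] -/
instance instFintypeCFam [Fintype B] (Adj : B → B → Prop) (s₀ : ℕ) : Fintype (CFam Adj s₀) := by
  classical
  exact Fintype.subtype ((univ : Finset (Finset B)).filter fun X => IsRConnected Adj X ∧ X.card ≤ s₀)
    fun X => by simp only [mem_filter, mem_univ, true_and]

/-- THE WALK STATES of [Balaban1985UV3] p. 262: pairs `(α, X)` — a label `α` from a finite type `Λ` (the index of the
operator `R_α(X)` of [5] (3.107), abstract here) and a connected union `X` of at most `s₀` big blocks.
[cite: Balaban1985UV3, p.262 (after (23))] -/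
abbrev State (Λ : Type) (Adj : B → B → Prop) (s₀ : ℕ) : Type := Λ × CFam Adj s₀

variable {Λ : Type} [Fintype Λ] [Fintype B]

/-- THE SUCCESSOR LISTS «X_{m−1} ∩ X_m ≠ ∅» (p. 262): the states whose block family MEETS that of the given state — a
common block, or a pair of blocks in the relation `Meet` —; the state itself is included (the convention of
`B9Thm37Sum.walksFrom`: «□ itself included»). [cite: Balaban1985UV3, p.262 (after (23))] -/
def stateNbrs (Meet Adj : B → B → Prop) (s₀ : ℕ) (q : State Λ Adj s₀) : Finset (State Λ Adj s₀) := by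
  classical
  exact univ.filter fun q' => Touches Meet q.2.1 q'.2.1

/-- Membership in the successor list is «the block families meet». [cite: Balaban1985UV3, p.262 (after (23); dictionary)] -/
@[simp] theorem mem_stateNbrs {Meet Adj : B → B → Prop} {s₀ : ℕ} {q q' : State Λ Adj s₀} :
    q' ∈ stateNbrs Meet Adj s₀ q ↔ Touches Meet q.2.1 q'.2.1 := by
  classical
  simp [stateNbrs]

/-- THE SHARE-A-BLOCK READING of «X_{m−1} ∩ X_m ≠ ∅» (the twin's `B10Eq25WalkGeometry.nbrs`) is the successor list for the
EMPTY meeting relation: the block families have a common block. [cite: Balaban1985UV3, p.262 (after (23); dictionary)] -/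
theorem mem_stateNbrs_share {Adj : B → B → Prop} {s₀ : ℕ} {q q' : State Λ Adj s₀} :
    q' ∈ stateNbrs (fun _ _ => False) Adj s₀ q ↔ (q.2.1 ∩ q'.2.1).Nonempty := by
  rw [mem_stateNbrs]
  constructor
  · rintro ⟨w, hw, x, hx, rfl | h⟩
    · exact ⟨w, mem_inter.2 ⟨hw, hx⟩⟩
    · exact h.elim
  · rintro ⟨w, hw⟩
    exact ⟨w, (mem_inter.1 hw).1, w, (mem_inter.1 hw).2, Or.inl rfl⟩

/-- The state itself is in its successor list («□ itself included», `B9Thm37Sum.walksFrom`): a non-empty block family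
meets itself. [cite: Balaban1985UV3, p.262 (after (23); bookkeeping)] -/
theorem self_mem_stateNbrs {Meet Adj : B → B → Prop} {s₀ : ℕ} (q : State Λ Adj s₀) :
    q ∈ stateNbrs Meet Adj s₀ q := by
  obtain ⟨b, hb⟩ := q.2.2.1.1
  exact mem_stateNbrs.2 ⟨b, hb, b, hb, Or.inl rfl⟩

omit [DecidableEq B] [Fintype Λ] [Fintype B] in
/-- The walk states are inhabited as soon as `s₀ ≥ 1` and there are a label and a block: `(α, {b})`.
[cite: Balaban1985UV3, p.262 (after (23); bookkeeping)] -/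
theorem nonempty_state {Adj : B → B → Prop} {s₀ : ℕ} (hs : 1 ≤ s₀) (α : Λ) (b : B) :
    Nonempty (State Λ Adj s₀) :=
  ⟨(α, ⟨{b}, ⟨⟨b, mem_singleton_self b⟩, fun v hv w hw => by
    rw [mem_singleton] at hv hw
    subst hv; subst hw
    exact Relation.ReflTransGen.refl⟩, by simpa using hs⟩)⟩

variable {Adj : B → B → Prop} {nbr : B → Finset B} {Δ : ℕ} {Meet : B → B → Prop} {mnbr : B → Finset B} {Θ : ℕ}

/-- **THE WALK-STATE ADJACENCY COUNT** ([Balaban1985UV3] p. 262 with [5] p. 410 «We will use the factor O(M^{−1/2}) to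
control the sum over random walks ω»): every walk state `(α, X)` has at most `D𝔤 = |Λ|·(s₀·Θ·(Δ+1)^{2(s₀−1)})` successors
— the hypothesis `hD` of `B9Thm37Sum.card_walksFrom_le`, `B10LogDet63.logHalfBound_of_walks`, `B10Eq25Rate.rate25`.
(`|Λ|` labels; `X` has `≤ s₀` blocks, each meeting `≤ Θ` blocks, through each of which pass `≤ (Δ+1)^{2(s₀−1)}` connected
families of `≤ s₀` blocks: §1.) [cite: Balaban1985UV3, p.262 (after (23))] -/
theorem card_stateNbrs_le (hAdj : ∀ x y, Adj x y → Adj y x) (hΔ : ∀ x, (nbr x).card ≤ Δ)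
    (hnbr : ∀ x y, Adj x y → y ∈ nbr x) (hself : ∀ x, x ∈ mnbr x) (hmnbr : ∀ x y, Meet x y → y ∈ mnbr x)
    (hΘ : ∀ x, (mnbr x).card ≤ Θ) (s₀ : ℕ) (q : State Λ Adj s₀) :
    (stateNbrs Meet Adj s₀ q).card ≤ Fintype.card Λ * (s₀ * Θ * (Δ + 1) ^ (2 * (s₀ - 1))) := by
  classical
  set T : Finset (CFam Adj s₀) := univ.filter fun X' => Touches Meet q.2.1 X'.1 with hT
  have hsub : stateNbrs Meet Adj s₀ q ⊆ univ ×ˢ T := by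
    intro q' hq'
    rw [mem_stateNbrs] at hq'
    exact mem_product.2 ⟨mem_univ _, mem_filter.2 ⟨mem_univ _, hq'⟩⟩
  have hinj : Set.InjOn (fun X' : CFam Adj s₀ => X'.1) ↑T := fun a _ b _ h => Subtype.ext h
  have hTle : T.card ≤ s₀ * Θ * (Δ + 1) ^ (2 * (s₀ - 1)) := by
    rw [← card_image_of_injOn hinj]
    have h := card_touching_connected_le hAdj hΔ hnbr hself hmnbr hΘ s₀ q.2.1 (T.image fun X' => X'.1)
      (fun Y hY => by
        obtain ⟨X', hX', rfl⟩ := mem_image.1 hY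
        exact ⟨(mem_filter.1 hX').2, X'.2.1, X'.2.2⟩)
    refine h.trans ?_
    exact Nat.mul_le_mul_right _ (Nat.mul_le_mul_right _ q.2.2.2)
  calc (stateNbrs Meet Adj s₀ q).card ≤ (univ ×ˢ T).card := card_le_card hsub
    _ = Fintype.card Λ * T.card := by rw [card_product, card_univ]
    _ ≤ Fintype.card Λ * (s₀ * Θ * (Δ + 1) ^ (2 * (s₀ - 1))) := Nat.mul_le_mul_left _ hTle

/-- **The count for the share-a-block reading** (Θ = 1: the meeting list of a block is the block itself): at most
`|Λ|·(s₀·(Δ+1)^{2(s₀−1)})` successors. [cite: Balaban1985UV3, p.262 (after (23))] -/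
theorem card_stateNbrs_share_le (hAdj : ∀ x y, Adj x y → Adj y x) (hΔ : ∀ x, (nbr x).card ≤ Δ)
    (hnbr : ∀ x y, Adj x y → y ∈ nbr x) (s₀ : ℕ) (q : State Λ Adj s₀) :
    (stateNbrs (fun _ _ => False) Adj s₀ q).card ≤ Fintype.card Λ * (s₀ * (Δ + 1) ^ (2 * (s₀ - 1))) := by
  have h := card_stateNbrs_le (Meet := fun _ _ => False) (mnbr := fun x => {x}) (Θ := 1) hAdj hΔ hnbr
    (fun x => mem_singleton_self x) (fun _ _ h => h.elim) (fun x => (card_singleton x).le) s₀ q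
  simpa using h

/-- The single-block states of [5] (3.90) («ω = (□₀, □₁, ⋯, □ₙ), □ᵢ ∩ □ᵢ₊₁ ≠ ∅», `s₀ = 1`): at most `|Λ|·Θ` successors
— with one label and the `3^d` closed cubes meeting a cube this is the «D = 3^d» of `B9Thm37Sum.card_walksFrom_le`'s
docstring. [cite: Balaban1985BackgroundPropagators, (3.90) p.409 and p.410] -/
theorem card_stateNbrs_le_of_one (hAdj : ∀ x y, Adj x y → Adj y x) (hΔ : ∀ x, (nbr x).card ≤ Δ)
    (hnbr : ∀ x y, Adj x y → y ∈ nbr x) (hself : ∀ x, x ∈ mnbr x) (hmnbr : ∀ x y, Meet x y → y ∈ mnbr x)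
    (hΘ : ∀ x, (mnbr x).card ≤ Θ) (q : State Λ Adj 1) :
    (stateNbrs Meet Adj 1 q).card ≤ Fintype.card Λ * Θ := by
  simpa using card_stateNbrs_le hAdj hΔ hnbr hself hmnbr hΘ 1 q

variable [DecidableEq Λ]

/-- Hence «the sum over random walks ω» ([5] p. 410) has at most `D𝔤ⁿ` terms of length `n` from a fixed state
(`B9Thm37Sum.card_walksFrom_le` BY NAME). [cite: Balaban1985BackgroundPropagators, p.410 (after (3.94))] -/
theorem card_walksFrom_state_le (hAdj : ∀ x y, Adj x y → Adj y x) (hΔ : ∀ x, (nbr x).card ≤ Δ)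
    (hnbr : ∀ x y, Adj x y → y ∈ nbr x) (hself : ∀ x, x ∈ mnbr x) (hmnbr : ∀ x y, Meet x y → y ∈ mnbr x)
    (hΘ : ∀ x, (mnbr x).card ≤ Θ) (s₀ n : ℕ) (q : State Λ Adj s₀) :
    (B9Thm37Sum.walksFrom (stateNbrs Meet Adj s₀) n q).card ≤
      (Fintype.card Λ * (s₀ * Θ * (Δ + 1) ^ (2 * (s₀ - 1)))) ^ n :=
  B9Thm37Sum.card_walksFrom_le _ (fun q' => card_stateNbrs_le hAdj hΔ hnbr hself hmnbr hΘ s₀ q') n q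

end States

/-! ## §3. The torus of big blocks: the union lemma and the two adjacency counts -/

section Torus

open TreeLengthTorus

variable {d N : ℕ}

/-- **THE UNION LEMMA ON THE TORUS**: two torus-face-connected families of cubes with a cube in common have a
torus-face-connected union ([Balaban1987RG1] p. 257's «connected family», periodic carrier; the `ℤ^d` statement is
`B13Ineq232.faceConnected_union`; chains are monotone in the family, `TreeLengthTorusTransfer.tLinked_mono`).
[cite: Balaban1987RG1, p.257 (connected families of cubes)] -/
theorem tFaceConnected_union {S T : Finset (TPt d N)} (hS : TFaceConnected S) (hT : TFaceConnected T)
    (h : (S ∩ T).Nonempty) : TFaceConnected (S ∪ T) := by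
  obtain ⟨z, hz⟩ := h
  rw [mem_inter] at hz
  intro x hx y hy
  rw [mem_union] at hx hy
  have hxz : TLinked (S ∪ T) x z := by
    rcases hx with hx | hx
    · exact TreeLengthTorusTransfer.tLinked_mono subset_union_left (hS x hx z hz.1)
    · exact TreeLengthTorusTransfer.tLinked_mono subset_union_right (hT x hx z hz.2)
  have hzy : TLinked (S ∪ T) z y := by
    rcases hy with hy | hy
    · exact TreeLengthTorusTransfer.tLinked_mono subset_union_left (hS z hz.1 y hy)
    · exact TreeLengthTorusTransfer.tLinked_mono subset_union_right (hT z hz.2 y hy)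
  exact TreeLengthTorusTransfer.tLinked_trans hxz hzy

/-- A single cube is a torus-face-connected family. [folklore] -/
private theorem tFaceConnected_singleton (a : TPt d N) : TFaceConnected ({a} : Finset (TPt d N)) := by
  intro x hx y hy
  rw [mem_singleton] at hx hy
  subst hx; subst hy
  exact Relation.ReflTransGen.refl

/-- `IsRConnected TAdj` (the connectedness field of `B12TreeDecay.CubeSystem`, used by the states of §2) gives back the
torus-face-connectedness of `TreeLengthTorus` (converse of `isRConnected_of_tFaceConnected`). [cite: Balaban1987RG1, p.257 (connected families of cubes; bookkeeping)] -/
theorem tFaceConnected_of_isRConnected {S : Finset (TPt d N)} (h : IsRConnected TAdj S) : TFaceConnected S := by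
  intro x hx y hy
  have hl := h.2 x hx y hy
  clear hy
  unfold TLinked
  induction hl with
  | refl => exact Relation.ReflTransGen.refl
  | tail _ hbc ih => exact ih.tail ⟨hbc.2.1, hbc.2.2, hbc.1⟩

variable [NeZero N] {Λ : Type} [Fintype Λ]

/-- **THE WALK-STATE ADJACENCY COUNT ON THE TORUS, contact reading**: for the states `(α, X)` of [Balaban1985UV3] p. 262
over the blocks `(ℤ/N)^d` of the torus — `X` a WALL-connected family (print's «connected», [Balaban1987RG1] p. 257) of
`≤ s₀` blocks, successors = states whose CLOSED block unions meet: some block `b` of the one lies in the enlarged cube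
`□̃(a) = tblock a` of a block `a` of the other (the `3^d` cubes within sup-distance one, [Balaban1987RG1] p. 257's □̃,
`TreeLengthTorusTransfer.tblock`) — every state has at most `D𝔤 = |Λ|·(s₀·3^d·(2d+1)^{2(s₀−1)})` successors (`tdegreeLE` :
every block has `≤ 2d` wall-neighbours; `card_tblock_le` : `≤ 3^d` cubes in □̃; `mem_tblock_self`).
[cite: Balaban1985UV3, p.262 (after (23))] -/
theorem card_stateNbrs_torus_le (s₀ : ℕ) (q : State Λ (TAdj (d := d) (N := N)) s₀) :
    (stateNbrs (fun a b : TPt d N => b ∈ TreeLengthTorusTransfer.tblock a) TAdj s₀ q).card ≤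
      Fintype.card Λ * (s₀ * 3 ^ d * (2 * d + 1) ^ (2 * (s₀ - 1))) := by
  have hΔ : ∀ a : TPt d N, (tnbr a).card ≤ 2 * d := fun a => tdegreeLE d N a
  exact card_stateNbrs_le (fun _ _ h => h.symm) hΔ (fun _ _ h => mem_tnbr.2 h) TreeLengthTorusTransfer.mem_tblock_self
    (fun _ _ h => h) TreeLengthTorusTransfer.card_tblock_le s₀ q

/-- **THE WALK-STATE ADJACENCY COUNT ON THE TORUS, share-a-block reading** (the twin's `card_nbrs_le`, periodic carrier,
lattice-animal constant): at most `D𝔤 = |Λ|·(s₀·(2d+1)^{2(s₀−1)})` successors. [cite: Balaban1985UV3, p.262 (after (23))] -/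
theorem card_stateNbrs_torus_share_le (s₀ : ℕ) (q : State Λ (TAdj (d := d) (N := N)) s₀) :
    (stateNbrs (fun _ _ => False) TAdj s₀ q).card ≤ Fintype.card Λ * (s₀ * (2 * d + 1) ^ (2 * (s₀ - 1))) := by
  have hΔ : ∀ a : TPt d N, (tnbr a).card ≤ 2 * d := fun a => tdegreeLE d N a
  exact card_stateNbrs_share_le (fun _ _ h => h.symm) hΔ (fun _ _ h => mem_tnbr.2 h) s₀ q

/-- The single-cube states of [5] (3.90) on the torus, contact reading: at most `|Λ|·3^d` successors («D = 3^d for the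
cubes of one family 𝒟_j», `B9Thm37Sum.card_walksFrom_le`). [cite: Balaban1985BackgroundPropagators, (3.90) p.409 and p.410] -/
theorem card_stateNbrs_torus_le_of_one (q : State Λ (TAdj (d := d) (N := N)) 1) :
    (stateNbrs (fun a b : TPt d N => b ∈ TreeLengthTorusTransfer.tblock a) TAdj 1 q).card ≤ Fintype.card Λ * 3 ^ d := by
  simpa using card_stateNbrs_torus_le (Λ := Λ) (d := d) (N := N) 1 q

variable [DecidableEq Λ]

/-- At most `D𝔤ⁿ` walks of `n` steps from a state, on the torus (contact reading). [cite: Balaban1985BackgroundPropagators, p.410 (after (3.94))] -/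
theorem card_walksFrom_torus_le (s₀ n : ℕ) (q : State Λ (TAdj (d := d) (N := N)) s₀) :
    (B9Thm37Sum.walksFrom (stateNbrs (fun a b : TPt d N => b ∈ TreeLengthTorusTransfer.tblock a) TAdj s₀) n q).card ≤
      (Fintype.card Λ * (s₀ * 3 ^ d * (2 * d + 1) ^ (2 * (s₀ - 1)))) ^ n :=
  B9Thm37Sum.card_walksFrom_le _ (fun q' => card_stateNbrs_torus_le s₀ q') n q

end Torus

/-! ## §4. The walk geometry on the torus: anchors, the union of a walk's states, the rescaling law (N), the volume law -/

section Walks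

open TreeLengthTorus

/-- Equality of torus localization domains is decidable (the instance `B10Eq25Rate.rate25` ∕
`B10Eq65PolymerSum.norm_total_le_of_bound25` ask of the domain type; same term as `B16Cor3Torus.instDecidableEqDom`). [folklore] -/
instance instDecidableEqTDom (d N : ℕ) [NeZero N] : DecidableEq (tsys d N).Dom :=
  fun X Y => decidable_of_iff (X.1 = Y.1) Subtype.ext_iff.symm

variable {d N : ℕ} [NeZero N] {Λ : Type} [Fintype Λ] [DecidableEq Λ] {s₀ : ℕ}

/-- «Each expression corresponds to a graph with vertices localized in cubes {□_j}» (p. 262): the labelled one-block state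
`(α, {b})` of an anchor `(α, b) ∈ Λ × (ℤ/N)^d` — the start of a walk term (needs `s₀ ≥ 1`).
[cite: Balaban1985UV3, p.262 (after (23))] -/
def single (hs : 1 ≤ s₀) (p : Λ × TPt d N) : State Λ (TAdj (d := d) (N := N)) s₀ :=
  (p.1, ⟨{p.2}, ⟨isRConnected_of_tFaceConnected (singleton_nonempty _) (tFaceConnected_singleton p.2),
    by simpa using hs⟩⟩)

omit [NeZero N] [Fintype Λ] [DecidableEq Λ] in
/-- The blocks of a one-block state. [cite: Balaban1985UV3, p.262 (after (23); bookkeeping)] -/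
@[simp] theorem single_blocks (hs : 1 ≤ s₀) (p : Λ × TPt d N) : (single hs p).2.1 = {p.2} := rfl

omit [NeZero N] [Fintype Λ] [DecidableEq Λ] in
/-- The label of a one-block state. [cite: Balaban1985UV3, p.262 (after (23); bookkeeping)] -/
@[simp] theorem single_label (hs : 1 ≤ s₀) (p : Λ × TPt d N) : (single hs p).1 = p.1 := rfl

omit [NeZero N] [Fintype Λ] [DecidableEq Λ] in
/-- Distinct anchors give distinct one-block states. [cite: Balaban1985UV3, p.262 (after (23); bookkeeping)] -/
theorem single_injective (hs : 1 ≤ s₀) : Function.Injective (single (Λ := Λ) (d := d) (N := N) hs) := by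
  intro p p' h
  have h1 : (single hs p).1 = (single hs p').1 := congrArg Prod.fst h
  have h2 : (single hs p).2.1 = (single hs p').2.1 := congrArg (fun q => q.2.1) h
  rw [single_label, single_label] at h1
  rw [single_blocks, single_blocks] at h2
  exact Prod.ext h1 (singleton_injective h2)

/-- The labelled one-block states of the blocks of a torus localization domain X — the count function `#cubes(X)` of
`B10Eq25Rate.rate25` ∕ `B13.VolBoundK1` at this carrier. [cite: Balaban1985UV3, p.262 (after (23); bookkeeping)] -/
def cubesQ (hs : 1 ≤ s₀) (X : (tsys d N).Dom) : Finset (State Λ (TAdj (d := d) (N := N)) s₀) :=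
  ((univ : Finset Λ) ×ˢ X.1).image (single hs)

/-- `#cubesQ(X) = |Λ|·#blocks(X)`. [cite: Balaban1985UV3, p.262 (after (23); bookkeeping)] -/
theorem card_cubesQ (hs : 1 ≤ s₀) (X : (tsys d N).Dom) :
    (cubesQ (Λ := Λ) hs X).card = Fintype.card Λ * X.1.card := by
  unfold cubesQ
  rw [card_image_of_injective _ (single_injective hs), card_product, card_univ]

/-- The one-block state of an anchor whose block lies in X is counted in `cubesQ X`. [cite: Balaban1985UV3, p.262 (after (23); bookkeeping)] -/
theorem single_mem_cubesQ (hs : 1 ≤ s₀) {X : (tsys d N).Dom} {p : Λ × TPt d N} (hp : p.2 ∈ X.1) :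
    single hs p ∈ cubesQ hs X :=
  mem_image.2 ⟨p, mem_product.2 ⟨mem_univ _, hp⟩, rfl⟩

/-- At most ONE anchor per state (the count `V = 1` of `B10Eq25Rate.rate25`'s hypothesis `hV`). [cite: Balaban1985UV3, p.262 (after (23); bookkeeping)] -/
theorem card_anchors_le_one (hs : 1 ≤ s₀) (q : State Λ (TAdj (d := d) (N := N)) s₀) :
    (univ.filter fun p : Λ × TPt d N => single hs p = q).card ≤ 1 := by
  refine card_le_one.2 fun p hp p' hp' => ?_
  rw [mem_filter] at hp hp'
  exact single_injective hs (hp.2.trans hp'.2.symm)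

/-- «This localization is simply a union of all these sets» (p. 262): the union of the block families of the states of a
walk. [cite: Balaban1985UV3, p.262 (after (23))] -/
def wunion : List (State Λ (TAdj (d := d) (N := N)) s₀) → Finset (TPt d N)
  | [] => ∅
  | q :: ω => q.2.1 ∪ wunion ω

omit [NeZero N] [Fintype Λ] [DecidableEq Λ] in
/-- The empty walk has no blocks. [cite: Balaban1985UV3, p.262 (after (23); bookkeeping)] -/
@[simp] theorem wunion_nil : wunion ([] : List (State Λ (TAdj (d := d) (N := N)) s₀)) = ∅ := rfl

omit [NeZero N] [Fintype Λ] [DecidableEq Λ] in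
/-- The blocks of a walk with a first state prepended. [cite: Balaban1985UV3, p.262 (after (23); bookkeeping)] -/
@[simp] theorem wunion_cons (q : State Λ (TAdj (d := d) (N := N)) s₀) (ω : List (State Λ (TAdj (d := d) (N := N)) s₀)) :
    wunion (q :: ω) = q.2.1 ∪ wunion ω := rfl

/-- **The walks of [5] (3.90) through the states, share-a-block reading** (`B9Thm37Sum.walksFrom`, n steps from `(α, X₀)`,
consecutive states sharing a block): the union of the states CONTAINS X₀, IS a torus localization domain (non-empty,
torus-face-connected — `tFaceConnected_union` along the shared blocks) and has at most `s₀(n + 1)` blocks.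
[cite: Balaban1985UV3, p.262 (after (23))] -/
theorem walk_props : ∀ (n : ℕ) (c : State Λ (TAdj (d := d) (N := N)) s₀) (ω : List (State Λ (TAdj (d := d) (N := N)) s₀)),
    ω ∈ B9Thm37Sum.walksFrom (stateNbrs (fun _ _ => False) TAdj s₀) n c →
      c.2.1 ⊆ wunion ω ∧ IsTDom (wunion ω) ∧ (wunion ω).card ≤ s₀ * (n + 1)
  | 0, c, ω, hω => by
      simp only [B9Thm37Sum.walksFrom, mem_singleton] at hω
      subst hω
      simp only [wunion_cons, wunion_nil, union_empty, zero_add, mul_one]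
      exact ⟨subset_rfl, ⟨c.2.2.1.1, tFaceConnected_of_isRConnected c.2.2.1⟩, c.2.2.2⟩
  | n + 1, c, ω, hω => by
      simp only [B9Thm37Sum.walksFrom, mem_biUnion, mem_image] at hω
      obtain ⟨c', hc', ω', hω', rfl⟩ := hω
      obtain ⟨hsub, hdom, hcard⟩ := walk_props n c' ω' hω'
      have hmeet : (c.2.1 ∩ wunion ω').Nonempty := by
        obtain ⟨z, hz⟩ := mem_stateNbrs_share.1 hc'
        rw [mem_inter] at hz
        exact ⟨z, mem_inter.2 ⟨hz.1, hsub hz.2⟩⟩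
      refine ⟨subset_union_left, ⟨?_, ?_⟩, ?_⟩
      · obtain ⟨b, hb⟩ := c.2.2.1.1
        exact ⟨b, mem_union_left _ hb⟩
      · rw [wunion_cons]
        exact tFaceConnected_union (tFaceConnected_of_isRConnected c.2.2.1) hdom.2 hmeet
      · rw [wunion_cons]
        calc (c.2.1 ∪ wunion ω').card ≤ c.2.1.card + (wunion ω').card := card_union_le _ _
          _ ≤ s₀ + s₀ * (n + 1) := add_le_add c.2.2.2 hcard
          _ = s₀ * (n + 1 + 1) := by ring

/-- **The localization X of the term anchored at `(α, b)` with walk ω** («This localization is simply a union of all these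
sets», p. 262) as an element of the torus system `tsys d N`: the union of the walk's states when it is a localization domain
containing the anchor block (always the case on the walks of `walksFrom` from the anchor's state, `domOf_val`), else the
anchor block (junk value making `domOf` total). [cite: Balaban1985UV3, p.262 (after (23))] -/
def domOf (_hs : 1 ≤ s₀) (p : Λ × TPt d N) (ω : List (State Λ (TAdj (d := d) (N := N)) s₀)) : (tsys d N).Dom := by
  classical
  exact if h : IsTDom (wunion ω) ∧ p.2 ∈ wunion ω then ⟨wunion ω, h.1⟩
    else ⟨{p.2}, ⟨singleton_nonempty _, tFaceConnected_singleton p.2⟩⟩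

/-- On the walks of (23) anchored at `(α, b)` the localization domain IS the union of the states. [cite: Balaban1985UV3, p.262 (after (23))] -/
theorem domOf_val {hs : 1 ≤ s₀} {p : Λ × TPt d N} {n : ℕ} {ω : List (State Λ (TAdj (d := d) (N := N)) s₀)}
    (hω : ω ∈ B9Thm37Sum.walksFrom (stateNbrs (fun _ _ => False) TAdj s₀) n (single hs p)) :
    (domOf hs p ω).1 = wunion ω := by
  classical
  obtain ⟨hsub, hdom, -⟩ := walk_props n (single hs p) ω hω
  have hb : p.2 ∈ wunion ω := hsub (by simp)
  unfold domOf
  rw [dif_pos ⟨hdom, hb⟩]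

omit [Fintype Λ] [DecidableEq Λ] in
/-- The anchor block belongs to the localization domain of its terms («□ᵢ ∩ X₀ ≠ ∅», p. 262). [cite: Balaban1985UV3, p.262 (after (23))] -/
theorem anchor_mem_domOf (hs : 1 ≤ s₀) (p : Λ × TPt d N) (ω : List (State Λ (TAdj (d := d) (N := N)) s₀)) :
    p.2 ∈ (domOf hs p ω).1 := by
  classical
  unfold domOf
  split_ifs with h
  · exact h.2
  · exact mem_singleton_self _

/-- The hypothesis `hstart` of `B10Eq25Rate.rate25` at this carrier: the anchor's one-block state is counted in `cubesQ` of
the term's localization domain. [cite: Balaban1985UV3, p.262 (after (23); bookkeeping)] -/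
theorem single_mem_cubesQ_domOf (hs : 1 ≤ s₀) (p : Λ × TPt d N) (n : ℕ)
    (ω : List (State Λ (TAdj (d := d) (N := N)) s₀))
    (_hω : ω ∈ B9Thm37Sum.walksFrom (stateNbrs (fun _ _ => False) TAdj s₀) n (single hs p)) :
    single hs p ∈ cubesQ hs (domOf hs p ω) :=
  single_mem_cubesQ hs (anchor_mem_domOf hs p ω)

/-- The localization domain of an n-step walk term has at most `s₀(n + 1)` blocks. [cite: Balaban1985UV3, p.262 (after (23))] -/
theorem card_domOf_le {hs : 1 ≤ s₀} {p : Λ × TPt d N} {n : ℕ} {ω : List (State Λ (TAdj (d := d) (N := N)) s₀)}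
    (hω : ω ∈ B9Thm37Sum.walksFrom (stateNbrs (fun _ _ => False) TAdj s₀) n (single hs p)) :
    (domOf hs p ω).1.card ≤ s₀ * (n + 1) := by
  rw [domOf_val hω]
  exact (walk_props n _ ω hω).2.2

/-- **The linear size of a walk's localization on the torus** («a linear size 𝓛(X) … if the big blocks are scaled to unit
cubes», p. 262): `𝓛(X((α,b), ω)) ≤ s₀·|ω| + s₀ − 1` — a torus-face-connected family of m blocks has linear size ≤ m − 1
(`TreeLengthTorus.torusTreeLen_le_card_sub_one`, (2.30) [Balaban1988RG2Cluster] upper half on the torus).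
[cite: Balaban1985UV3, p.262 (before (25))] -/
theorem torusTreeLen_domOf_le {hs : 1 ≤ s₀} {p : Λ × TPt d N} {n : ℕ} {ω : List (State Λ (TAdj (d := d) (N := N)) s₀)}
    (hω : ω ∈ B9Thm37Sum.walksFrom (stateNbrs (fun _ _ => False) TAdj s₀) n (single hs p)) :
    torusTreeLen (domOf hs p ω).1 ≤ (s₀ : ℝ) * n + ((s₀ : ℝ) - 1) := by
  have hX := (domOf hs p ω).2
  have h1 := torusTreeLen_le_card_sub_one hX.1 hX.2
  have h2 : ((domOf hs p ω).1.card : ℝ) ≤ (s₀ : ℝ) * (n + 1) := by exact_mod_cast card_domOf_le hω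
  linarith

/-- **THE RESCALING LAW, COUNT FORM (N), ON THE TORUS** — the hypothesis `B10Eq25Rate.RescaleLaw` (cell GAPS C-b10g12-1:
instances «neither is typed»; the twin proves (N) on windows) on the periodic carrier: for every nonnegative walk distance
`wd` (unused: Λ = 0) and `M ≥ 0`, `M·𝓛(X((α,b), ω)) ≤ 0·d(ω, □ᵢ, □ⱼ) + M·(s₀·|ω| + s₀)`.
[cite: Balaban1985UV3, p.262 (before (25))] -/
theorem rescaleLaw_torus (hs : 1 ≤ s₀) (wd : Λ × TPt d N → List (State Λ (TAdj (d := d) (N := N)) s₀) → ℝ)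
    (hwd : ∀ p ω, 0 ≤ wd p ω) {M : ℝ} (hM : 0 ≤ M) :
    RescaleLaw (tsys d N) (stateNbrs (fun _ _ => False) TAdj s₀) (single hs) (domOf hs) wd M 0 s₀ s₀ := by
  intro p n ω hω
  refine ⟨hwd p ω, ?_⟩
  rw [tsys_dj, zero_mul, zero_add]
  have h := torusTreeLen_domOf_le hω
  have hs1 : (1 : ℝ) ≤ s₀ := by exact_mod_cast hs
  nlinarith [h, hs1, torusTreeLen_nonneg (domOf hs p ω).1]

/-- **THE VOLUME LAW for the labelled count function on the torus**: `#cubesQ(X) = |Λ|·#blocks(X) ≤ |Λ|·4·2^d·(1 + 𝓛(X))` —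
`B13.VolBoundK1 (tsys d N) (#cubesQ) (|Λ|·4·2^d)` from `TreeLengthTorus.tvolumeLeaf` BY NAME.
[cite: Balaban1988RG2Cluster, (2.30) p.18 (lower half, repaired form)] -/
theorem volBoundK1_torus (hs : 1 ≤ s₀) :
    B13.VolBoundK1 (tsys d N) (fun X => (cubesQ (Λ := Λ) (s₀ := s₀) hs X).card)
      (Fintype.card Λ * (4 * 2 ^ d)) := by
  intro X
  have h := tvolumeLeaf d N X
  rw [tcubeSys_vol] at h
  show ((cubesQ hs X).card : ℝ) ≤ _
  rw [card_cubesQ]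
  push_cast
  have hΛ : (0 : ℝ) ≤ Fintype.card Λ := Nat.cast_nonneg _
  calc (Fintype.card Λ : ℝ) * (X.1.card : ℝ) ≤ (Fintype.card Λ : ℝ) * (4 * 2 ^ d * (1 + (tsys d N).dj X)) :=
        mul_le_mul_of_nonneg_left h hΛ
    _ = Fintype.card Λ * (4 * 2 ^ d) * (1 + (tsys d N).dj X) := by ring

end Walks

/-! ## §5. (23) ⇒ (25) ⇒ the first clause of (65) ON THE TORUS — every geometric hypothesis discharged -/

section Assembly

open TreeLengthTorus

variable {d N : ℕ} [NeZero N] {Λ : Type} [Fintype Λ] [DecidableEq Λ] {s₀ : ℕ} {Φ : Type}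

/-- **(23) ⇒ (25) ON THE TORUS OF BIG BLOCKS, every geometric hypothesis discharged** («With this definition we have (25)
… where κ can be arbitrarily large if M₁ is sufficiently large»): for every rate `κ ≥ 0`, every `M₁ > 0` past the entropy
threshold `2·D𝔤·c·e^{κs₀} ≤ M₁`, `D𝔤 = |Λ|·(s₀·(2d+1)^{2(s₀−1)})`, and every `g > 0`, the analytic leaf (23)
`WalkTermBound23 (tsys d N) (stateNbrs ⊥ TAdj s₀) (single hs) (domOf hs) sp term wd (A₀g) C c M₁ δ₀` ALONE gives
`B10.Bound25Printed` for the regrouped terms `B10LogDet63.Elog` with rate `κ − 1` and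
`O(g₀) = (2A₀C·e^{κs₀}·|Λ|·4·2^d)·g₀` — `B10Eq25Rate.bound25_of_bound23` with `hD := card_stateNbrs_torus_share_le`,
`hV := card_anchors_le_one`, `hstart := single_mem_cubesQ_domOf`, `hsc := rescaleLaw_torus`, `hvol := volBoundK1_torus`
(Λ = 0, ℓ₀ = ℓ₁ = s₀, V = 1, c₁ = |Λ|·4·2^d). [cite: Balaban1985UV3, (23)–(25) p.262] -/
theorem bound25_torus (hs : 1 ≤ s₀) {sp : (tsys d N).Dom → Set Φ}
    {term : Λ × TPt d N → List (State Λ (TAdj (d := d) (N := N)) s₀) → Φ → ℂ}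
    {wd : Λ × TPt d N → List (State Λ (TAdj (d := d) (N := N)) s₀) → ℝ} (hwd : ∀ p ω, 0 ≤ wd p ω)
    {A₀ C c M δ₀ κ g : ℝ} {R : Set Φ}
    (hM : 0 < M) (hA₀ : 0 ≤ A₀) (hC : 0 ≤ C) (hc : 0 ≤ c) (hδ₀ : 0 < δ₀) (hκ : 0 ≤ κ) (hg : 0 < g)
    (hMent : 2 * (((Fintype.card Λ * (s₀ * (2 * d + 1) ^ (2 * (s₀ - 1))) : ℕ) : ℝ) * (c * Real.exp (κ * s₀))) ≤ M)
    (h23 : WalkTermBound23 (tsys d N) (stateNbrs (fun _ _ => False) TAdj s₀) (single hs) (domOf hs) sp term wd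
      (A₀ * g) C c M δ₀)
    (hR : ∀ X, R ⊆ sp X) :
    B10.Bound25Printed
      (activitiesOf (tsys d N) (B10LogDet63.Elog (stateNbrs (fun _ _ => False) TAdj s₀) (single hs) (domOf hs) term) R)
      g (κ - 1) (2 * A₀ * C * Real.exp (κ * s₀) * (Fintype.card Λ * (4 * 2 ^ d))) := by
  have hMκ : 2 * κ * 0 / δ₀ ≤ M := by simp; exact hM.le
  have h := bound25_of_bound23 (cubes := cubesQ hs) (Dg := Fintype.card Λ * (s₀ * (2 * d + 1) ^ (2 * (s₀ - 1))))
    (V := 1) (fun q => card_stateNbrs_torus_share_le s₀ q) (fun q => card_anchors_le_one hs q)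
    (fun p n ω hω => single_mem_cubesQ_domOf hs p n ω hω) hM hA₀ hC hc hδ₀ hκ hg hMκ hMent h23
    (rescaleLaw_torus hs wd hwd hM.le) (volBoundK1_torus hs) hR
  simpa only [Nat.cast_one, mul_one] using h

/-- **(23) ⇒ THE FIRST CLAUSE OF (65) ON THE TORUS** («From (25), which holds for arbitrary j, we get easily |E^{(j)}| ≤
O(1)|T₁^{(j)}|», p. 273): under the same hypotheses and `κ − 1 ≥ κ₀(4·2^d, 2d)`, the regrouped terms summed over ALL torus
localization domains obey `‖Σ_X E_log(X, U)‖ ≤ (2A₀Ce^{κs₀}·|Λ|·4·2^d)·g·K₀(4·2^d, 2d)·N^d` at every real configuration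
`U ∈ R` — `N^d = |π₁|`, the number of big blocks of the torus (`= M₁^{−d}|T₁|`, print's «O(1)|T₁^{(j)}|») —
`B10Eq65PolymerSum.norm_total_le_of_bound25` over `tcubeSys d N` (`tdegreeLE`, `tvolumeLeaf`, `card_tcube`) BY NAME, fed by
`bound25_torus`. [cite: Balaban1985UV3, (65) p.273] -/
theorem norm_total_torus (hs : 1 ≤ s₀) {sp : (tsys d N).Dom → Set Φ}
    {term : Λ × TPt d N → List (State Λ (TAdj (d := d) (N := N)) s₀) → Φ → ℂ}
    {wd : Λ × TPt d N → List (State Λ (TAdj (d := d) (N := N)) s₀) → ℝ} (hwd : ∀ p ω, 0 ≤ wd p ω)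
    {A₀ C c M δ₀ κ g : ℝ} {R : Set Φ}
    (hM : 0 < M) (hA₀ : 0 ≤ A₀) (hC : 0 ≤ C) (hc : 0 ≤ c) (hδ₀ : 0 < δ₀) (hκ : 0 ≤ κ) (hg : 0 < g)
    (hMent : 2 * (((Fintype.card Λ * (s₀ * (2 * d + 1) ^ (2 * (s₀ - 1))) : ℕ) : ℝ) * (c * Real.exp (κ * s₀))) ≤ M)
    (hκ' : kappa₀ (4 * 2 ^ d) (2 * d) ≤ κ - 1)
    (h23 : WalkTermBound23 (tsys d N) (stateNbrs (fun _ _ => False) TAdj s₀) (single hs) (domOf hs) sp term wd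
      (A₀ * g) C c M δ₀)
    (hR : ∀ X, R ⊆ sp X) (U : R) :
    ‖∑ X : (tsys d N).Dom, B10LogDet63.Elog (stateNbrs (fun _ _ => False) TAdj s₀) (single hs) (domOf hs) term X (U : Φ)‖
      ≤ (2 * A₀ * C * Real.exp (κ * s₀) * (Fintype.card Λ * (4 * 2 ^ d))) * g * K₀ (4 * 2 ^ d) (2 * d) *
          (N ^ d : ℕ) := by
  have h := B10Eq65PolymerSum.norm_total_le_of_bound25 (tcubeSys d N) (tdegreeLE d N) (tvolumeLeaf d N) hκ' _ R
    (by positivity) (bound25_torus hs hwd hM hA₀ hC hc hδ₀ hκ hg hMent h23 hR) U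
  rwa [card_tcube] at h

end Assembly

/-! ## §6. (v1.1, append-only) The CONTACT reading at the geometry level: the walk's localization fattened by □̃ -/

section ContactWalks

open TreeLengthTorus

variable {d N : ℕ} [NeZero N] {Λ : Type} [Fintype Λ] [DecidableEq Λ] {s₀ : ℕ}

/-- «This localization is simply a union of all these sets» (p. 262) UNDER THE CLOSED-BLOCK-CONTACT READING of
«X_{m−1} ∩ X_m ≠ ∅», repaired by one layer of cubes: the union of the ENLARGED block families `X̃_m = tcollar X_m`
([Balaban1987RG1] p. 257's X̃, `TreeLengthTorusTransfer.tcollar`) of the states of a walk — the plain union of families in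
corner contact need not be a connected family of cubes, the □̃-fattened one is (`cwalk_props`). [cite: Balaban1985UV3, p.262 (after (23))] -/
def cwunion : List (State Λ (TAdj (d := d) (N := N)) s₀) → Finset (TPt d N)
  | [] => ∅
  | q :: ω => TreeLengthTorusTransfer.tcollar q.2.1 ∪ cwunion ω

omit [NeZero N] [Fintype Λ] [DecidableEq Λ] in
/-- The empty walk has no blocks. [cite: Balaban1985UV3, p.262 (after (23); bookkeeping)] -/
@[simp] theorem cwunion_nil : cwunion ([] : List (State Λ (TAdj (d := d) (N := N)) s₀)) = ∅ := rfl

omit [NeZero N] [Fintype Λ] [DecidableEq Λ] in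
/-- The fattened blocks of a walk with a first state prepended. [cite: Balaban1985UV3, p.262 (after (23); bookkeeping)] -/
@[simp] theorem cwunion_cons (q : State Λ (TAdj (d := d) (N := N)) s₀)
    (ω : List (State Λ (TAdj (d := d) (N := N)) s₀)) :
    cwunion (q :: ω) = TreeLengthTorusTransfer.tcollar q.2.1 ∪ cwunion ω := rfl

/-- **The walks of [5] (3.90) through the states, CONTACT reading** (consecutive states have a block of the one inside the
enlarged cube □̃ of a block of the other): the □̃-fattened union of the states CONTAINS `X̃₀`, IS a torus localization domain
(`tFaceConnected_tcollar` + `tFaceConnected_union`: the contact block lies in both enlarged families) and has at most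
`3^d·s₀·(n + 1)` blocks (`card_tcollar_le`). [cite: Balaban1985UV3, p.262 (after (23))] -/
theorem cwalk_props : ∀ (n : ℕ) (c : State Λ (TAdj (d := d) (N := N)) s₀)
    (ω : List (State Λ (TAdj (d := d) (N := N)) s₀)),
    ω ∈ B9Thm37Sum.walksFrom (stateNbrs (fun a b : TPt d N => b ∈ TreeLengthTorusTransfer.tblock a) TAdj s₀) n c →
      TreeLengthTorusTransfer.tcollar c.2.1 ⊆ cwunion ω ∧ IsTDom (cwunion ω) ∧ (cwunion ω).card ≤ 3 ^ d * s₀ * (n + 1)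
  | 0, c, ω, hω => by
      simp only [B9Thm37Sum.walksFrom, mem_singleton] at hω
      subst hω
      simp only [cwunion_cons, cwunion_nil, union_empty, zero_add, mul_one]
      obtain ⟨b, hb⟩ := c.2.2.1.1
      refine ⟨subset_rfl, ⟨⟨b, TreeLengthTorusTransfer.subset_tcollar _ hb⟩,
        TreeLengthTorusTransfer.tFaceConnected_tcollar (tFaceConnected_of_isRConnected c.2.2.1)⟩, ?_⟩
      exact (TreeLengthTorusTransfer.card_tcollar_le _).trans (Nat.mul_le_mul_left _ c.2.2.2)
  | n + 1, c, ω, hω => by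
      simp only [B9Thm37Sum.walksFrom, mem_biUnion, mem_image] at hω
      obtain ⟨c', hc', ω', hω', rfl⟩ := hω
      obtain ⟨hsub, hdom, hcard⟩ := cwalk_props n c' ω' hω'
      have hmeet : (TreeLengthTorusTransfer.tcollar c.2.1 ∩ cwunion ω').Nonempty := by
        obtain ⟨a, ha, b, hb, hab⟩ := mem_stateNbrs.1 hc'
        have hb1 : b ∈ TreeLengthTorusTransfer.tcollar c.2.1 := by
          rcases hab with rfl | hab
          · exact TreeLengthTorusTransfer.subset_tcollar _ ha
          · exact TreeLengthTorusTransfer.tblock_subset_tcollar ha hab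
        have hb2 : b ∈ cwunion ω' := hsub (TreeLengthTorusTransfer.subset_tcollar _ hb)
        exact ⟨b, mem_inter.2 ⟨hb1, hb2⟩⟩
      refine ⟨subset_union_left, ⟨?_, ?_⟩, ?_⟩
      · obtain ⟨b, hb⟩ := c.2.2.1.1
        exact ⟨b, mem_union_left _ (TreeLengthTorusTransfer.subset_tcollar _ hb)⟩
      · rw [cwunion_cons]
        exact tFaceConnected_union
          (TreeLengthTorusTransfer.tFaceConnected_tcollar (tFaceConnected_of_isRConnected c.2.2.1)) hdom.2 hmeet
      · rw [cwunion_cons]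
        calc (TreeLengthTorusTransfer.tcollar c.2.1 ∪ cwunion ω').card
            ≤ (TreeLengthTorusTransfer.tcollar c.2.1).card + (cwunion ω').card := card_union_le _ _
          _ ≤ 3 ^ d * s₀ + 3 ^ d * s₀ * (n + 1) :=
              add_le_add ((TreeLengthTorusTransfer.card_tcollar_le _).trans (Nat.mul_le_mul_left _ c.2.2.2)) hcard
          _ = 3 ^ d * s₀ * (n + 1 + 1) := by ring

/-- **The localization of the term anchored at `(α, b)` with walk ω, CONTACT reading**: the □̃-fattened union of the
walk's states as an element of `tsys d N` (junk value the anchor block off the walks of `walksFrom`). [cite: Balaban1985UV3, p.262 (after (23))] -/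
def cdomOf (_hs : 1 ≤ s₀) (p : Λ × TPt d N) (ω : List (State Λ (TAdj (d := d) (N := N)) s₀)) : (tsys d N).Dom := by
  classical
  exact if h : IsTDom (cwunion ω) ∧ p.2 ∈ cwunion ω then ⟨cwunion ω, h.1⟩
    else ⟨{p.2}, ⟨singleton_nonempty _, tFaceConnected_singleton p.2⟩⟩

/-- On the walks from the anchor's state the contact localization IS the fattened union. [cite: Balaban1985UV3, p.262 (after (23))] -/
theorem cdomOf_val {hs : 1 ≤ s₀} {p : Λ × TPt d N} {n : ℕ} {ω : List (State Λ (TAdj (d := d) (N := N)) s₀)}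
    (hω : ω ∈ B9Thm37Sum.walksFrom
      (stateNbrs (fun a b : TPt d N => b ∈ TreeLengthTorusTransfer.tblock a) TAdj s₀) n (single hs p)) :
    (cdomOf hs p ω).1 = cwunion ω := by
  classical
  obtain ⟨hsub, hdom, -⟩ := cwalk_props n (single hs p) ω hω
  have hb : p.2 ∈ cwunion ω := hsub (TreeLengthTorusTransfer.subset_tcollar _ (by simp))
  unfold cdomOf
  rw [dif_pos ⟨hdom, hb⟩]

omit [Fintype Λ] [DecidableEq Λ] in
/-- The anchor block belongs to the contact localization of its terms. [cite: Balaban1985UV3, p.262 (after (23))] -/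
theorem anchor_mem_cdomOf (hs : 1 ≤ s₀) (p : Λ × TPt d N) (ω : List (State Λ (TAdj (d := d) (N := N)) s₀)) :
    p.2 ∈ (cdomOf hs p ω).1 := by
  classical
  unfold cdomOf
  split_ifs with h
  · exact h.2
  · exact mem_singleton_self _

/-- `hstart` for the contact reading: the anchor's one-block state is counted in `cubesQ` of the contact localization.
[cite: Balaban1985UV3, p.262 (after (23); bookkeeping)] -/
theorem single_mem_cubesQ_cdomOf (hs : 1 ≤ s₀) (p : Λ × TPt d N) (n : ℕ)
    (ω : List (State Λ (TAdj (d := d) (N := N)) s₀))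
    (_hω : ω ∈ B9Thm37Sum.walksFrom
      (stateNbrs (fun a b : TPt d N => b ∈ TreeLengthTorusTransfer.tblock a) TAdj s₀) n (single hs p)) :
    single hs p ∈ cubesQ hs (cdomOf hs p ω) :=
  single_mem_cubesQ hs (anchor_mem_cdomOf hs p ω)

/-- The contact localization of an n-step walk term has at most `3^d·s₀·(n + 1)` blocks. [cite: Balaban1985UV3, p.262 (after (23))] -/
theorem card_cdomOf_le {hs : 1 ≤ s₀} {p : Λ × TPt d N} {n : ℕ} {ω : List (State Λ (TAdj (d := d) (N := N)) s₀)}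
    (hω : ω ∈ B9Thm37Sum.walksFrom
      (stateNbrs (fun a b : TPt d N => b ∈ TreeLengthTorusTransfer.tblock a) TAdj s₀) n (single hs p)) :
    (cdomOf hs p ω).1.card ≤ 3 ^ d * s₀ * (n + 1) := by
  rw [cdomOf_val hω]
  exact (cwalk_props n _ ω hω).2.2

/-- The linear size of the contact localization: `𝓛 ≤ 3^d·s₀·n + 3^d·s₀ − 1` ((2.30) upper half on the torus BY NAME).
[cite: Balaban1985UV3, p.262 (before (25))] -/
theorem torusTreeLen_cdomOf_le {hs : 1 ≤ s₀} {p : Λ × TPt d N} {n : ℕ}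
    {ω : List (State Λ (TAdj (d := d) (N := N)) s₀)}
    (hω : ω ∈ B9Thm37Sum.walksFrom
      (stateNbrs (fun a b : TPt d N => b ∈ TreeLengthTorusTransfer.tblock a) TAdj s₀) n (single hs p)) :
    torusTreeLen (cdomOf hs p ω).1 ≤ (3 ^ d * s₀ : ℝ) * n + ((3 ^ d * s₀ : ℝ) - 1) := by
  have hX := (cdomOf hs p ω).2
  have h1 := torusTreeLen_le_card_sub_one hX.1 hX.2
  have h2 : ((cdomOf hs p ω).1.card : ℝ) ≤ (3 ^ d * s₀ : ℝ) * (n + 1) := by exact_mod_cast card_cdomOf_le hω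
  linarith

/-- **THE RESCALING LAW (N) FOR THE CONTACT READING ON THE TORUS**: `M·𝓛(X̃((α,b), ω)) ≤ 0·d + M·(3^d s₀·|ω| + 3^d s₀)` —
the count law with the □̃-fattening constant (one layer of cubes per state; constants-only repair of print's «simply a
union» under corner contact). [cite: Balaban1985UV3, p.262 (before (25))] -/
theorem rescaleLaw_torus_contact (hs : 1 ≤ s₀)
    (wd : Λ × TPt d N → List (State Λ (TAdj (d := d) (N := N)) s₀) → ℝ) (hwd : ∀ p ω, 0 ≤ wd p ω) {M : ℝ}
    (hM : 0 ≤ M) :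
    RescaleLaw (tsys d N) (stateNbrs (fun a b : TPt d N => b ∈ TreeLengthTorusTransfer.tblock a) TAdj s₀) (single hs)
      (cdomOf hs) wd M 0 (3 ^ d * s₀) (3 ^ d * s₀) := by
  intro p n ω hω
  refine ⟨hwd p ω, ?_⟩
  rw [tsys_dj, zero_mul, zero_add]
  have h := torusTreeLen_cdomOf_le hω
  have hs1 : (1 : ℝ) ≤ 3 ^ d * s₀ := by
    have h3 : (1 : ℝ) ≤ 3 ^ d := one_le_pow₀ (by norm_num)
    have hs' : (1 : ℝ) ≤ s₀ := by exact_mod_cast hs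
    nlinarith
  nlinarith [h, hs1, torusTreeLen_nonneg (cdomOf hs p ω).1]

end ContactWalks

section ContactAssembly

open TreeLengthTorus

variable {d N : ℕ} [NeZero N] {Λ : Type} [Fintype Λ] [DecidableEq Λ] {s₀ : ℕ} {Φ : Type}

/-- **(23) ⇒ (25) ON THE TORUS, CONTACT READING, every geometric hypothesis discharged**: as `bound25_torus` with the
successor lists «a block inside □̃ of a block» (`hD := card_stateNbrs_torus_le`, `D𝔤 = |Λ|·(s₀·3^d·(2d+1)^{2(s₀−1)})`) and the
□̃-fattened localizations (`hsc := rescaleLaw_torus_contact`, `ℓ₀ = ℓ₁ = 3^d s₀`); threshold `2·D𝔤·c·e^{κ·3^d s₀} ≤ M₁`,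
`O(g₀) = (2A₀C·e^{κ·3^d s₀}·|Λ|·4·2^d)·g₀`, rate `κ − 1`. [cite: Balaban1985UV3, (23)–(25) p.262] -/
theorem bound25_torus_contact (hs : 1 ≤ s₀) {sp : (tsys d N).Dom → Set Φ}
    {term : Λ × TPt d N → List (State Λ (TAdj (d := d) (N := N)) s₀) → Φ → ℂ}
    {wd : Λ × TPt d N → List (State Λ (TAdj (d := d) (N := N)) s₀) → ℝ} (hwd : ∀ p ω, 0 ≤ wd p ω)
    {A₀ C c M δ₀ κ g : ℝ} {R : Set Φ}
    (hM : 0 < M) (hA₀ : 0 ≤ A₀) (hC : 0 ≤ C) (hc : 0 ≤ c) (hδ₀ : 0 < δ₀) (hκ : 0 ≤ κ) (hg : 0 < g)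
    (hMent : 2 * (((Fintype.card Λ * (s₀ * 3 ^ d * (2 * d + 1) ^ (2 * (s₀ - 1))) : ℕ) : ℝ) *
      (c * Real.exp (κ * (3 ^ d * s₀ : ℝ)))) ≤ M)
    (h23 : WalkTermBound23 (tsys d N) (stateNbrs (fun a b : TPt d N => b ∈ TreeLengthTorusTransfer.tblock a) TAdj s₀)
      (single hs) (cdomOf hs) sp term wd (A₀ * g) C c M δ₀)
    (hR : ∀ X, R ⊆ sp X) :
    B10.Bound25Printed
      (activitiesOf (tsys d N)
        (B10LogDet63.Elog (stateNbrs (fun a b : TPt d N => b ∈ TreeLengthTorusTransfer.tblock a) TAdj s₀) (single hs)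
          (cdomOf hs) term) R)
      g (κ - 1) (2 * A₀ * C * Real.exp (κ * (3 ^ d * s₀ : ℝ)) * (Fintype.card Λ * (4 * 2 ^ d))) := by
  have hMκ : 2 * κ * 0 / δ₀ ≤ M := by simp; exact hM.le
  have h := bound25_of_bound23 (cubes := cubesQ hs)
    (Dg := Fintype.card Λ * (s₀ * 3 ^ d * (2 * d + 1) ^ (2 * (s₀ - 1)))) (V := 1)
    (fun q => card_stateNbrs_torus_le s₀ q) (fun q => card_anchors_le_one hs q)
    (fun p n ω hω => single_mem_cubesQ_cdomOf hs p n ω hω) hM hA₀ hC hc hδ₀ hκ hg hMκ hMent h23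
    (rescaleLaw_torus_contact hs wd hwd hM.le) (volBoundK1_torus hs) hR
  simpa only [Nat.cast_one, mul_one] using h

/-- **(23) ⇒ (65)₁ ON THE TORUS, CONTACT READING**: `‖Σ_X E_log(X, U)‖ ≤ (2A₀Ce^{κ·3^d s₀}·|Λ|·4·2^d)·g·K₀(4·2^d, 2d)·N^d` for
`κ − 1 ≥ κ₀(4·2^d, 2d)` (`B10Eq65PolymerSum.norm_total_le_of_bound25` over `tcubeSys d N` BY NAME, fed by
`bound25_torus_contact`). [cite: Balaban1985UV3, (65) p.273] -/
theorem norm_total_torus_contact (hs : 1 ≤ s₀) {sp : (tsys d N).Dom → Set Φ}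
    {term : Λ × TPt d N → List (State Λ (TAdj (d := d) (N := N)) s₀) → Φ → ℂ}
    {wd : Λ × TPt d N → List (State Λ (TAdj (d := d) (N := N)) s₀) → ℝ} (hwd : ∀ p ω, 0 ≤ wd p ω)
    {A₀ C c M δ₀ κ g : ℝ} {R : Set Φ}
    (hM : 0 < M) (hA₀ : 0 ≤ A₀) (hC : 0 ≤ C) (hc : 0 ≤ c) (hδ₀ : 0 < δ₀) (hκ : 0 ≤ κ) (hg : 0 < g)
    (hMent : 2 * (((Fintype.card Λ * (s₀ * 3 ^ d * (2 * d + 1) ^ (2 * (s₀ - 1))) : ℕ) : ℝ) *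
      (c * Real.exp (κ * (3 ^ d * s₀ : ℝ)))) ≤ M)
    (hκ' : kappa₀ (4 * 2 ^ d) (2 * d) ≤ κ - 1)
    (h23 : WalkTermBound23 (tsys d N) (stateNbrs (fun a b : TPt d N => b ∈ TreeLengthTorusTransfer.tblock a) TAdj s₀)
      (single hs) (cdomOf hs) sp term wd (A₀ * g) C c M δ₀)
    (hR : ∀ X, R ⊆ sp X) (U : R) :
    ‖∑ X : (tsys d N).Dom,
        B10LogDet63.Elog (stateNbrs (fun a b : TPt d N => b ∈ TreeLengthTorusTransfer.tblock a) TAdj s₀) (single hs)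
          (cdomOf hs) term X (U : Φ)‖
      ≤ (2 * A₀ * C * Real.exp (κ * (3 ^ d * s₀ : ℝ)) * (Fintype.card Λ * (4 * 2 ^ d))) * g *
          K₀ (4 * 2 ^ d) (2 * d) * (N ^ d : ℕ) := by
  have h := B10Eq65PolymerSum.norm_total_le_of_bound25 (tcubeSys d N) (tdegreeLE d N) (tvolumeLeaf d N) hκ' _ R
    (by positivity) (bound25_torus_contact hs hwd hM hA₀ hC hc hδ₀ hκ hg hMent h23 hR) U
  rwa [card_tcube] at h

end ContactAssembly

end Literature.MathematicalPhysics.QuantumFieldTheory.Balaban1983to89.B10Eq25WalkGeometryTorus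

end
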